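import Literature.AlgebraicGeometry.Resolution.FrobeniusNormIdeal
import Literature.AlgebraicGeometry.Resolution.BlowupsIntegral
import Literature.AlgebraicGeometry.Resolution.BlowupsProperProofs
import Literature.AlgebraicGeometry.Resolution.AffineBlowupUniversal
import Literature.AlgebraicGeometry.Resolution.AffineBlowupIntegral
import Literature.AlgebraicGeometry.Resolution.BlowupsLocal
import Literature.AlgebraicGeometry.Resolution.BlowupsScaling
import Literature.AlgebraicGeometry.Resolution.IdealSheafLemmas
import Mathlib.AlgebraicGeometry.FunctionField
import Mathlib.Algebra.CharP.Algebra
import HarnessLib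

/-!
# F-blowups (Yasuda): the universal flattening of the `e`-th Frobenius

Topic: `Literature/AlgebraicGeometry/Resolution`. Definition request `defn-FBlowup` (consumer:
crux `WeightedThesis`, line `kunz-tower-exceptional-defect`, stub `stub_fblowupExists`).

T. Yasuda, *Universal flattening of Frobenius* (Amer. J. Math. 134 (2012) = arXiv:0706.2700),
working over a perfect field `k` of characteristic `p > 0` with a variety `X` (separated integral
scheme of finite type) of dimension `d`, `q = p^e`, `X_e = Spec 𝒪_X^{1/q}`, `F^e : X_e → X`:

> **Definition 2.2.** We define the `e`-th F-blowup of `X`, denoted `FB_e(X)`, to be the closure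
> of `ι(X_sm)` [in `Hilb_{q^d}(X_e)`, `ι(x) = (F^e)⁻¹(x)`].
> **Proposition 2.5.** The `X`-scheme `FB_e(X)` is isomorphic to the irreducible component of
> the relative Hilbert scheme `Hilb_{q^d}(X_e/X)` that dominates `X`.
> **Corollary 2.6.** The morphism `FB_e(X) → X` is projective and birational, moreover an
> isomorphism over `X_sm`. … Hence `FB_e(X)` is the universal flattening of `𝒪_X^{1/q}`.

Mathlib has neither Hilbert/Quot schemes nor coherent sheaves with torsion, so the notion is
rendered through the equivalent **blow-up description** of the universal (birational)
flattening of a module, O. Villamayor U., *On flattening of coherent sheaves and of projective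
morphisms*, J. Algebra 295 (2006):

> **Theorem 3.3.** Let `M` be a finitely generated `A`-module, generically flat of generic rank
> `r`. There is a blow-up `Spec(A) ← X` with the following (universal) property: (1)
> `π^*(M)/tor(π^*(M))` is a locally free sheaf of `𝒪_X`-modules of rank `r`. (2) For any morphism
> `Spec(A) ← Y`, for which `γ^*(M)/tor(γ^*(M))` is a flat `𝒪_Y`-sheaf of local rank `r`, there is a
> unique morphism `β : Y → X` such that `β · π = γ`. *Proof.* … we set `Spec(A) ← X` as the
> blow-up at the fractionary ideal `[[M]]` (at any representative). Recall here that isomorphic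
> fractionary ideals define the same blow-up. …
> **3.4.** … The universal property expressed in the theorem allows us to extend it to the
> non-affine case … over each affine open, say `Spec(A)`, we blow up at some representative of
> `[[M]]`. Any representative defines the same morphism over `Spec(A)`, so it suffices to check
> that these morphisms patch; and this follows from the definition of `[[M]]`.

with `M = F^e_* 𝒪_X = 𝒪_X^{1/q}` and `[[F^e_* A]]` the **Frobenius norm ideal** of
`FrobeniusNormIdeal.lean` (`IsFrobeniusNormIdeal`, Villamayor §2 in the dictionary
`F^e_* K ≅ (K over K^q)`).

## Content

* `IsFBlowup p e π` — **`π : Y ⟶ X` is an `e`-th F-blowup of the integral scheme `X`** (of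
  characteristic `p`, i.e. `ExpChar` of its function field is `p`): over every nonempty affine
  open `U = Spec A ⊆ X`, `π` is a blowing up (`IsBlowup`, the universal property of
  Görtz–Wedhorn Def. 13.90, `Blowups.lean`) of `U ≅ Spec Γ(X, U)` along the ideal sheaf `Ĩ`
  (`affineBlowup.idealSheaf`) of a Frobenius norm ideal `I = [[F^e_* Γ(X, U)]]`
  (Villamayor 3.4 = Yasuda Def. 2.2 / Cor. 2.6). A predicate, like `IsBlowup`; the blowing up
  along any representative is determined up to unique `X`-isomorphism
  (`IsFrobeniusNormIdeal.exists_mul_eq_mul`: two representatives satisfy `f J = g I`).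
* PROVED from the definition and the tree's blow-up theory:
  `IsFBlowup.isIntegral_preimage` (each `π⁻¹(U)` is integral, Stacks 02ND via
  `IsBlowup.isIntegral`), `IsFBlowup.isIntegral` (**`Y` is integral**: reducedness is
  stalk-local, irreducibility because the `π⁻¹(U)` are irreducible and pairwise meet),
  `IsFBlowup.isProper` (**`π` is proper** for `X` locally Noetherian — "projective" in Yasuda
  Cor. 2.6; properness is local on the base and blow-ups of Noetherian affine schemes are proper,
  `IsBlowup.isProper`), `IsFBlowup.isBirational` (**`π` is birational**, Yasuda Cor. 2.6: an
  isomorphism over the complement of `V(I)` in one affine chart, `IsBlowup.isIso_compl`),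
  `IsFBlowup.iso_comp` (transport along isomorphisms of the source);
  `charP_functionField` / `expChar_functionField` (the characteristic hypothesis from the rings
  of sections).

## What is NOT here (follow-ups, same topic)

* EXISTENCE (`FB_e X` as data): gluing the affine blowing ups `Bl_{I_U}(U)` of chosen
  representatives along the canonical isomorphisms (Villamayor 3.4; pattern of
  `BlowupsExistence.lean`), which needs the compatibility of Frobenius norms with localisation
  and finiteness `[K : K^q] < ∞` (true for varieties over perfect fields); uniqueness up to
  isomorphism; Yasuda Prop. 2.7 (Kunz: `π` iso ⇔ `X` regular), Props. 2.9–2.15 (compatibility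
  with étale maps, completion, products, smooth maps, field extension).
* The Hilbert-scheme description (Yasuda Def. 2.2 verbatim) and the flattening universal
  property (Villamayor Thm. 3.3 (1)–(2)) — no Quot schemes / torsion of coherent sheaves in Mathlib.

## Sources

* T. Yasuda, Amer. J. Math. 134 (2012) 349–378 = arXiv:0706.2700v5, §2.1: Def. 2.2, Prop. 2.3,
  Prop. 2.5, Cor. 2.6 (read from the arXiv text). [Yasuda2012]
* O. Villamayor U., J. Algebra 295 (2006) 119–140: §2 ((2.0.1), Prop. 2.5), Thm. 3.3, 3.4
  (pp. 122–128, read). [Villamayoru2006]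
* The Stacks Project, Tags 02ND, 02NS, 02OS (through `Blowups*.lean`). [StacksProject]
-/

noncomputable section

open CategoryTheory CategoryTheory.Limits AlgebraicGeometry TopologicalSpace

namespace Literature.AlgebraicGeometry.Resolution

universe u

/-! ## The characteristic of the function field -/

/-- The function field of an integral scheme has the characteristic of its rings of sections
(these inject into it). [folklore] -/
theorem charP_functionField {X : Scheme.{u}} [IsIntegral X] (U : X.Opens) [Nonempty U] (p : ℕ)
    [CharP Γ(X, U) p] : CharP X.functionField p :=
  charP_of_injective_algebraMap (X.germToFunctionField_injective U) p

/-- The function field of an integral scheme has the exponential characteristic of its rings of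
sections. [folklore] -/
theorem expChar_functionField {X : Scheme.{u}} [IsIntegral X] (U : X.Opens) [Nonempty U] (p : ℕ)
    [ExpChar Γ(X, U) p] : ExpChar X.functionField p :=
  expChar_of_injective_algebraMap (X.germToFunctionField_injective U) p

/-! ## F-blowups -/

section Defs

variable (p : ℕ) (e : ℕ)

/-- **`π : Y ⟶ X` is an `e`-th F-blowup of `X`** (Yasuda 2012, Def. 2.2, in the blow-up form of
Cor. 2.6 / Villamayor 2006, Thm. 3.3 and 3.4): `X` is an integral scheme whose function field
`K` has (exponential) characteristic `p`, and over every nonempty affine open `U ⊆ X` the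
morphism `π`, restricted over `U` and read through `U ≅ Spec Γ(X, U)`, is a blowing up of
`Spec Γ(X, U)` along the ideal sheaf of a **Frobenius norm ideal**
`I = [[F^e_* Γ(X, U)]] ⊆ Γ(X, U)` (`IsFrobeniusNormIdeal K p e I`), i.e. it is the blow-up of
`U` at the module `F^e_* 𝒪_U = 𝒪_U^{1/q}`, `q = p^e`. Any two representatives `I, J` of the norm
satisfy `f J = g I` with `f, g ≠ 0` (`IsFrobeniusNormIdeal.exists_mul_eq_mul`), so the local
blow-ups do not depend on the representative, and `π` is determined up to unique isomorphism
over `X`. For `X` a variety over a perfect field this is Yasuda's `FB_e(X) → X`, the universal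
flattening of the `e`-th Frobenius `F^e : X_e → X`.
[cite: Yasuda2012, Def. 2.2 and Cor. 2.6; Villamayoru2006, Thm. 3.3 and 3.4] -/
structure IsFBlowup {Y X : Scheme.{u}} [IsIntegral X] [ExpChar X.functionField p]
    (π : Y ⟶ X) : Prop where
  /-- over each nonempty affine open `U`, `π` is the blowing up of a Frobenius norm ideal -/
  exists_isBlowup : ∀ (U : X.affineOpens) [Nonempty (U : X.Opens)],
    ∃ I : Ideal Γ(X, U), IsFrobeniusNormIdeal X.functionField p e I ∧
      IsBlowup (π ∣_ (U : X.Opens) ≫ U.2.isoSpec.hom) (affineBlowup.idealSheaf I)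

end Defs

namespace IsFBlowup

/-- Affine opens exist around every point of a scheme. [folklore] -/
theorem exists_affineOpens_mem {X : Scheme.{u}} (x : X) :
    ∃ U : X.affineOpens, x ∈ (U : X.Opens) := by
  obtain ⟨W, hW, hxW, -⟩ :=
    exists_isAffineOpen_mem_and_subset (X := X) (x := x) (U := ⊤) (Opens.mem_top x)
  exact ⟨⟨W, hW⟩, hxW⟩

variable {p : ℕ} {e : ℕ} {Y X : Scheme.{u}} [IsIntegral X] [ExpChar X.functionField p]
  {π : Y ⟶ X}

/-- **Each chart `π⁻¹(U)` of an F-blowup is an integral scheme** (`U` nonempty affine): it is a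
blowing up of the integral affine scheme `U ≅ Spec Γ(X, U)` along the nonzero ideal sheaf of a
Frobenius norm ideal (Stacks 02ND, `IsBlowup.isIntegral`; `IsFrobeniusNormIdeal.ne_bot`).
[cite: StacksProject, Tag 02ND] -/
theorem isIntegral_preimage (h : IsFBlowup p e π) (U : X.affineOpens) [Nonempty (U : X.Opens)] :
    IsIntegral (π ⁻¹ᵁ (U : X.Opens) : Scheme.{u}) := by
  obtain ⟨I, hI, hb⟩ := h.exists_isBlowup U
  haveI : IsFractionRing Γ(X, U) X.functionField :=
    functionField_isFractionRing_of_isAffineOpen X U U.2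
  have hI0 : I ≠ ⊥ := hI.ne_bot
  exact hb.isIntegral (affineBlowup.idealSheaf_ne_bot hI0)

/-- The underlying set of a chart `π⁻¹(U)` (`U` nonempty affine) is irreducible. [folklore] -/
theorem isIrreducible_preimage (h : IsFBlowup p e π) (U : X.affineOpens)
    [Nonempty (U : X.Opens)] :
    IsIrreducible ((π ⁻¹ᵁ (U : X.Opens) : Y.Opens) : Set Y) := by
  haveI := h.isIntegral_preimage U
  have : ((π ⁻¹ᵁ (U : X.Opens) : Y.Opens) : Set Y) = (π ⁻¹ᵁ (U : X.Opens)).ι '' Set.univ := by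
    rw [Set.image_univ, Scheme.Opens.range_ι]
  rw [this]
  exact (IrreducibleSpace.isIrreducible_univ _).image _ (Scheme.Hom.continuous _).continuousOn

/-- **The source of an F-blowup of an integral scheme is integral** (Yasuda: `FB_e(X)` is a
variety): reduced because every stalk is a stalk of one of the integral charts `π⁻¹(U)`;
irreducible because the charts are irreducible opens any two of which contain a third (the
chart of an affine open inside `U₁ ∩ U₂ ≠ ∅`). [cite: Yasuda2012, Cor. 2.6] -/
theorem isIntegral (h : IsFBlowup p e π) : IsIntegral Y := by
  -- every point of `Y` lies in a chart
  have hchart : ∀ y : Y, ∃ U : X.affineOpens, π y ∈ (U : X.Opens) := fun y =>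
    exists_affineOpens_mem (π y)
  -- reduced
  haveI : IsReduced Y := by
    haveI : ∀ y : Y, _root_.IsReduced (Y.presheaf.stalk y) := fun y => by
      obtain ⟨U, hyU⟩ := hchart y
      haveI : Nonempty (U : X.Opens) := ⟨⟨π y, hyU⟩⟩
      haveI := h.isIntegral_preimage U
      let V : Y.Opens := π ⁻¹ᵁ (U : X.Opens)
      let y' : V := ⟨y, hyU⟩
      let i := (V.stalkIso y').commRingCatIsoToRingEquiv
      exact isReduced_of_injective i.symm.toRingHom i.symm.injective
    exact isReduced_of_isReduced_stalk Y
  -- irreducible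
  haveI : IrreducibleSpace Y := by
    obtain ⟨x⟩ := (inferInstance : Nonempty X)
    obtain ⟨U₀, hxU₀⟩ := exists_affineOpens_mem x
    haveI : Nonempty (U₀ : X.Opens) := ⟨⟨x, hxU₀⟩⟩
    haveI := h.isIntegral_preimage U₀
    obtain ⟨y₀⟩ := (inferInstance : Nonempty (π ⁻¹ᵁ (U₀ : X.Opens) : Scheme.{u}))
    haveI : Nonempty Y := ⟨y₀.1⟩
    haveI : PreirreducibleSpace Y := by
      refine ⟨fun u v hu hv hu' hv' => ?_⟩
      obtain ⟨y₁, -, hy₁⟩ := hu'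
      obtain ⟨y₂, -, hy₂⟩ := hv'
      obtain ⟨U₁, h₁⟩ := hchart y₁
      obtain ⟨U₂, h₂⟩ := hchart y₂
      haveI : Nonempty (U₁ : X.Opens) := ⟨⟨π y₁, h₁⟩⟩
      haveI : Nonempty (U₂ : X.Opens) := ⟨⟨π y₂, h₂⟩⟩
      -- an affine open inside `U₁ ∩ U₂ ≠ ∅`
      obtain ⟨x₃, hx₃⟩ := nonempty_preirreducible_inter (U₁ : X.Opens).2 (U₂ : X.Opens).2
        ⟨π y₁, h₁⟩ ⟨π y₂, h₂⟩
      obtain ⟨W, hW, hxW, hWle⟩ := exists_isAffineOpen_mem_and_subset (X := X) (x := x₃)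
        (U := (U₁ : X.Opens) ⊓ (U₂ : X.Opens)) hx₃
      let U₃ : X.affineOpens := ⟨W, hW⟩
      haveI : Nonempty (U₃ : X.Opens) := ⟨⟨x₃, hxW⟩⟩
      -- the charts
      have hV₁ := (h.isIrreducible_preimage U₁).isPreirreducible
      have hV₂ := (h.isIrreducible_preimage U₂).isPreirreducible
      have hV₃ := (h.isIrreducible_preimage U₃).nonempty
      have h31 : ((π ⁻¹ᵁ (U₃ : X.Opens) : Y.Opens) : Set Y) ⊆ (π ⁻¹ᵁ (U₁ : X.Opens) : Y.Opens) :=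
        fun z hz => (hWle hz).1
      have h32 : ((π ⁻¹ᵁ (U₃ : X.Opens) : Y.Opens) : Set Y) ⊆ (π ⁻¹ᵁ (U₂ : X.Opens) : Y.Opens) :=
        fun z hz => (hWle hz).2
      -- in `V₁`: `u` meets `V₃`
      obtain ⟨z, -, hzu, hz₃⟩ := hV₁ u _ hu (π ⁻¹ᵁ (U₃ : X.Opens)).2 ⟨y₁, h₁, hy₁⟩
        (by obtain ⟨w, hw⟩ := hV₃; exact ⟨w, h31 hw, hw⟩)
      -- in `V₂`: `u ∩ V₃` meets `v`
      obtain ⟨t, -, ⟨htu, -⟩, htv⟩ := hV₂ _ v (hu.inter (π ⁻¹ᵁ (U₃ : X.Opens)).2) hv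
        ⟨z, h32 hz₃, hzu, hz₃⟩ ⟨y₂, h₂, hy₂⟩
      exact ⟨t, Set.mem_univ t, htu, htv⟩
    exact ⟨inferInstance⟩
  exact isIntegral_of_irreducibleSpace_of_isReduced Y

/-- **An F-blowup of a locally Noetherian integral scheme is proper** (Yasuda Cor. 2.6:
"projective"; properness is local on the base, and over a nonempty affine open `U` the morphism
is a blowing up of the Noetherian affine scheme `Spec Γ(X, U)`, proper by Stacks 02NS =
`IsBlowup.isProper`). [cite: Yasuda2012, Cor. 2.6] -/
theorem isProper [IsLocallyNoetherian X] (h : IsFBlowup p e π) : IsProper π := by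
  refine IsZariskiLocalAtTarget.of_iSup_eq_top (P := @IsProper)
    (fun U : {U : X.affineOpens // Nonempty (U : X.Opens)} => (U.1 : X.Opens)) ?_ fun U => ?_
  · rw [eq_top_iff]
    rintro x -
    obtain ⟨U, hxU⟩ := exists_affineOpens_mem x
    exact Opens.mem_iSup.mpr ⟨⟨U, ⟨⟨x, hxU⟩⟩⟩, hxU⟩
  · obtain ⟨U, hU⟩ := U
    obtain ⟨I, -, hb⟩ := h.exists_isBlowup U
    haveI : IsNoetherianRing Γ(X, U) := IsLocallyNoetherian.component_noetherian U
    have h1 : IsProper (π ∣_ (U : X.Opens) ≫ U.2.isoSpec.hom) := hb.isProper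
    exact (MorphismProperty.cancel_right_of_respectsIso @IsProper _ _).mp h1

/-- **An F-blowup is birational** (Yasuda Cor. 2.6): over a nonempty affine chart
`U ≅ Spec Γ(X, U)` it is a blowing up along a nonzero ideal sheaf, hence an isomorphism over
the nonempty open complement `O` of the centre (`IsBlowup.isIso_compl`, Stacks 02OS); `O` is
dense in the irreducible `X` and `π⁻¹(O) ≅ O` is dense in the irreducible `Y`.
[cite: Yasuda2012, Cor. 2.6] -/
theorem isBirational (h : IsFBlowup p e π) : IsBirational π := by
  haveI := h.isIntegral
  obtain ⟨x⟩ := (inferInstance : Nonempty X)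
  obtain ⟨U, hxU⟩ := exists_affineOpens_mem x
  haveI : Nonempty (U : X.Opens) := ⟨⟨x, hxU⟩⟩
  obtain ⟨I, hI, hb⟩ := h.exists_isBlowup U
  haveI : IsFractionRing Γ(X, U) X.functionField :=
    functionField_isFractionRing_of_isAffineOpen X U U.2
  have hJ : affineBlowup.idealSheaf I ≠ ⊥ := affineBlowup.idealSheaf_ne_bot hI.ne_bot
  -- `π ∣_ U` is a blowing up of `U` along `Ĩ` moved to `U`
  have hb' : IsBlowup (π ∣_ (U : X.Opens))
      ((affineBlowup.idealSheaf I).comap U.2.isoSpec.hom) := by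
    have := hb.comp_iso U.2.isoSpec.symm
    rwa [Iso.symm_hom, Iso.symm_inv, Category.assoc, Iso.hom_inv_id, Category.comp_id] at this
  -- hence an isomorphism over the complement `W` of the centre, a nonempty open of `U`
  have h2 : IsIso (π ∣_ (U : X.Opens) ∣_
      centreCompl ((affineBlowup.idealSheaf I).comap U.2.isoSpec.hom)) := hb'.isIso_compl
  have h3 : IsIso (π ∣_ ((U : X.Opens).ι ''ᵁ
      centreCompl ((affineBlowup.idealSheaf I).comap U.2.isoSpec.hom))) :=
    ((MorphismProperty.isomorphisms Scheme).arrow_mk_iso_iff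
      (morphismRestrictRestrict π (U : X.Opens) _)).mp h2
  have hWne : ((centreCompl ((affineBlowup.idealSheaf I).comap U.2.isoSpec.hom) :
      (U : X.Opens).toScheme.Opens) : Set (U : X.Opens)).Nonempty := by
    obtain ⟨s, hs⟩ := centreCompl_nonempty hJ
    refine ⟨U.2.isoSpec.inv s, ?_⟩
    have hs' : s ∉ ((affineBlowup.idealSheaf I).support : Set (Spec Γ(X, U))) := hs
    have heq : U.2.isoSpec.hom (U.2.isoSpec.inv s) = s :=
      U.2.isoSpec.schemeIsoToHomeo.apply_symm_apply s
    change U.2.isoSpec.inv s ∉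
      ((((affineBlowup.idealSheaf I).comap U.2.isoSpec.hom)).support : Set (U : X.Opens))
    rw [Scheme.IdealSheafData.support_comap]
    change ¬ (U.2.isoSpec.hom (U.2.isoSpec.inv s) ∈
      ((affineBlowup.idealSheaf I).support : Set (Spec Γ(X, U))))
    rwa [heq]
  -- the corresponding open `O = U.ι '' W` of `X` is dense with dense preimage
  have hOne : (((U : X.Opens).ι ''ᵁ
      centreCompl ((affineBlowup.idealSheaf I).comap U.2.isoSpec.hom) : X.Opens) :
        Set X).Nonempty := by
    obtain ⟨s, hs⟩ := hWne
    exact ⟨(U : X.Opens).ι s, s, hs, rfl⟩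
  refine ⟨_, (Opens.isOpen _).dense hOne, (π ⁻¹ᵁ _).2.dense ?_, h3⟩
  obtain ⟨o, ho⟩ := hOne
  obtain ⟨y, -⟩ := (Scheme.Hom.homeomorph (π ∣_ ((U : X.Opens).ι ''ᵁ
    centreCompl ((affineBlowup.idealSheaf I).comap U.2.isoSpec.hom)))).surjective ⟨o, ho⟩
  exact ⟨y.1, y.2⟩

/-- F-blowups transport along isomorphisms of the source. [folklore] -/
theorem iso_comp (h : IsFBlowup p e π) {Y' : Scheme.{u}} (f : Y' ≅ Y) :
    IsFBlowup p e (f.hom ≫ π) := by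
  refine ⟨fun U _ => ?_⟩
  obtain ⟨I, hI, hb⟩ := h.exists_isBlowup U
  refine ⟨I, hI, ?_⟩
  have h' := hb.iso_comp (asIso (f.hom ∣_ π ⁻¹ᵁ (U : X.Opens)))
  rw [asIso_hom, ← Category.assoc] at h'
  rw [morphismRestrict_comp]
  exact h'

end IsFBlowup

end Literature.AlgebraicGeometry.Resolution

end
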